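import Summits.QuantumFields.BalabanUV.Beta.D1BFx.TowerEquationForms
import Literature.MathematicalPhysics.QuantumFieldTheory.Balaban1983to89.Beta.KernelSpecInstance

/-!
# `BalabanUV.Beta.D1BFx.KernelFormOperators` — road «BF-x» for binder row D1, slot (K), dictionary brick B4 (OPS):
# THE KERNEL OPERATORS ON BOUNDED FORMS — `(K f)(p) = Σ'_q K(p,q)·f(q)` for a decaying unit-leg kernel `K` and a BOUNDED 0-form `f`
# (and the 1-form twin over `MKer 4 (Fin 4)` columns), their uniform bounds, linearity, FUBINI `K (K′ f) = (K ∘ K′) f`, the passage of the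
# finite stencils `d`, `δd`, block sums, `curv`, `curvAdj`, `δ`, `𝒬` through `Σ'`, `R = 1 − P` on forms, and `Q′·(G′(R g)) = 0` (brick B1 read on forms)

K-R1-SPEC v2 §2 ∕ owner claim table `HOME/b2b-balaban-beta-d1-p2/DICT-BRICKS.md` row B4 (owner GO, journal 18:13Z).  Bricks B5–B7 manipulate 0-forms
`P g`, `G′ f`, `R g := g − P g` and 1-forms `Σ'_z Σ_l Ga(x,z)_{κl} b_l(z)` over the road's decaying kernels (`Pgt`, `Ggh`, `Rgt`, `Ga`) and BOUNDED data; every step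
there exchanges a finite stencil or a second kernel with an absolutely convergent lattice series.  THIS FILE supplies that bookkeeping once, generically:
§1 [our object] `kerOp K f := (p ↦ Σ'_q K(p,q)·f(q))`, `kerOp₁ K b := ((κ,x) ↦ Σ'_z Σ_l K(x,z)_{κl}·b_l(z))`, `Pf n a := kerOp (Pgt n a)`, `Rf n a g := g − Pf n a g`
(DATA definitions, assert nothing; the owner's B5 `TowerEquationForms.Gf n a f` IS `kerOp (Ggh n a) f`, `rfl`); §2 (`Decays K C δ`, `0 < δ`, `|f| ≤ M`) summability,
`hasSum_kerOp`, the UNIFORM bound `|kerOp K f p| ≤ C·Zl 4 δ·M`, linearity, `kerOp_Rgt` ∕ `Rf_eq_kerOp_Rgt` (`R = 1 − P` on forms), bounds for `Pf`∕`Rf`; §3 FUBINI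
`kerOp_kerOp : kerOp K (kerOp K′ f) = kerOp (comp K K′) f` and the owner-requested raw export `tsum_ker_mul_tsum`; §4 «FINITE STENCILS PASS THROUGH `Σ'`»: `d`, `δ∘d`
(the shape B3∕B5 read `Δ₀∘P`, `Δ₀∘G′` in), finite ∕ block sums of `kerOp K f`; for `kerOp₁`: summability, uniform bound, `curv`, `curvAdj∘curv`, `δ`, `𝒬 = contourSum n`
through `Σ'` (`KernelSpecInstance` §2 BY NAME); §5 brick B1 ON FORMS: `comp (Ggh n a) (Rgt n a) (p,q) = RG (Ggh n a) (Pgt n a) (q,p)` and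
**`blockSum_Gf_Rf_eq_zero : blockSum n (Gf n a (Rf n a g)) y = 0`** for bounded `g` (`LandauMultiplierMean.sum_blk_tsum_RG_mul_eq_zero`, `TowerEquationForms.sum_B_eq_blockSum`).

HONEST FRAMING (cell contract, verbatim): «discharging `BetaPertH` makes Bałaban's UV stability UNCONDITIONAL — a real constructive-QFT
result; it is NOT the continuum limit and NOT the Clay problem.»  HONEST DEPENDENCY (verbatim): «continuum YM on T⁴ ⇐ BetaPertH ∧ nine
spine estimates (0/9 proved); BetaPertH ⇐ (D1) ∧ (D4) ∧ CAP+tail; G-an2-4 gates asym, D1 and NE2/3/4.»  [folklore] absolutely convergent lattice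
bookkeeping about the CELL'S OWN typed objects; no `Prop` is minted, nothing is cited, no wall binder is instantiated; 0 sorry.  NOT D1, NOT summit progress.
ABSOLUTE RULE (cell, verbatim): «No internally-minted statement may enter as a cited fact. Every hypothesis is either kernel-proved in this
package or a verbatim quotation of a PUBLISHED theorem with page reference. The manuscript(s) under audit are NOT citable for their own
disputed steps — they are the thing under adjudication; programme-internal (2001/route/tribunal) claims are never citable.»
Provenance: D1 formalisation swarm, unit `b2b-balaban-beta-d1-formalise-leaf-03` (gen 6), claim «DICT-B4», 2026-08-20.
-/

namespace Summit.QuantumFields.BalabanUV.Beta.D1BFx.KernelFormOperators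

open Literature.MathematicalPhysics.QuantumFieldTheory.Balaban1983to89
open Literature.MathematicalPhysics.QuantumFieldTheory.Balaban1983to89.Beta
open ExpKernelCalculus (Site MKer Decays comp Zl Zl_nonneg summable_exp_shift tsum_exp_shift)
open AffineAveraging (Form0 Form1 Form2 unitVec dz curv curvAdj codiff₁ blockSum contourSum box toSite)
open KernelSpecInstance (hasSum_dz hasSum_curv hasSum_curvAdj hasSum_codiff₁ hasSum_contourSum)
open B6QGQLower276 (B)
open B12Sec2to5 (l1 l1_nonneg)
open Summit.QuantumFields.BalabanUV.Beta.TameKernelCalculus (Spr)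
open GhostLeg (Ggh Ggh_symm spr_Ggh)
open RProjector (Pgt Pgt_symm deltaPP_pos)
open RProjectorJet (RG)
open RJetProjector (Rgt Rgt_apply decays_Rgt decays_Pgt)
open LandauMultiplierMean (spr_Pgt sum_blk_tsum_RG_mul_eq_zero summable_Pgt_mul_Ggh)
open TowerEquationForms (Gf sum_B_eq_blockSum)

noncomputable section

/-! ## §1 The objects -/

/-- [our object] **THE 0-FORM OPERATOR OF A UNIT-LEG KERNEL**: `(kerOp K f)(p) := Σ'_q K(p,q)·f(q)` (unconditional sum; junk value on a
non-summable family, which never occurs below: every use is under `Decays K C δ`, `0 < δ`, bounded `f`).  A definition; asserts nothing. -/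
def kerOp (K : MKer 4 Unit) (f : Form0 4 ℝ) : Form0 4 ℝ := fun p => ∑' q : Site 4, K p q () () * f q

/-- [our object] **THE 1-FORM OPERATOR OF A `Fin 4`-LEG KERNEL** (columns `z ↦ K(x,z)_{κl}`, e.g. `GluonLeg.Ga n a`):
`(kerOp₁ K b)_κ(x) := Σ'_z Σ_l K(x,z)_{κl}·b_l(z)`.  A definition; asserts nothing. -/
def kerOp₁ (K : MKer 4 (Fin 4)) (b : Form1 4 ℝ) : Form1 4 ℝ := fun κ x => ∑' z : Site 4, ∑ l, K x z κ l * b l z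

/-- [our object] Unfolding of `kerOp`. -/
theorem kerOp_apply (K : MKer 4 Unit) (f : Form0 4 ℝ) (p : Site 4) : kerOp K f p = ∑' q : Site 4, K p q () () * f q := rfl

/-- [our object] **`P` ON FORMS**: `Pf n a g := kerOp (Pgt n a) g` — J5.0's gauge-term projector `P = Pgt n a` applied to a 0-form. -/
def Pf (n : ℕ) (a : ℝ) (g : Form0 4 ℝ) : Form0 4 ℝ := kerOp (Pgt n a) g

/-- [our object] **`R = 1 − P` ON FORMS**: `Rf n a g := g − Pf n a g`. -/
def Rf (n : ℕ) (a : ℝ) (g : Form0 4 ℝ) : Form0 4 ℝ := g - Pf n a g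

/-- [our object] Unfolding of `Pf`. -/
theorem Pf_eq_kerOp (n : ℕ) (a : ℝ) (g : Form0 4 ℝ) : Pf n a g = kerOp (Pgt n a) g := rfl

/-- [our object] Unfolding of `Rf`. -/
theorem Rf_eq (n : ℕ) (a : ℝ) (g : Form0 4 ℝ) : Rf n a g = g - kerOp (Pgt n a) g := rfl

/-- [our object] The owner's tower operator `TowerEquationForms.Gf n a` IS `kerOp (Ggh n a)` (`rfl`). -/
theorem Gf_eq_kerOp (n : ℕ) [NeZero n] (a : ℝ) (f : Form0 4 ℝ) : Gf n a f = kerOp (Ggh n a) f := rfl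

/-! ## §2 Summability, the uniform bound, linearity; `R = 1 − P` on forms -/

section Zero

variable {K K' : MKer 4 Unit} {C C' δ δ' M M' : ℝ} {f g : Form0 4 ℝ}

/-- [folklore] The bound of a bounded form is nonnegative. -/
theorem bound_nonneg (hf : ∀ q, |f q| ≤ M) : 0 ≤ M := (abs_nonneg _).trans (hf 0)

/-- [folklore] Termwise majorant: `|K(p,q) f(q)| ≤ (C·M)·e^{−δ|p−q|₁}`. -/
theorem abs_ker_mul_le (hK : Decays K C δ) (hf : ∀ q, |f q| ≤ M) (p q : Site 4) :
    |K p q () () * f q| ≤ C * M * Real.exp (-δ * l1 (p - q)) := by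
  rw [abs_mul]
  calc |K p q () ()| * |f q| ≤ (C * Real.exp (-δ * l1 (p - q))) * M :=
        mul_le_mul (hK p q () ()) (hf q) (abs_nonneg _) ((abs_nonneg _).trans (hK p q () ()))
    _ = C * M * Real.exp (-δ * l1 (p - q)) := by ring

/-- [folklore] **ROW SUMMABILITY**: a decaying row against a bounded form is absolutely summable. -/
theorem summable_ker_mul (hK : Decays K C δ) (hδ : 0 < δ) (hf : ∀ q, |f q| ≤ M) (p : Site 4) :
    Summable fun q : Site 4 => K p q () () * f q :=
  Summable.of_norm_bounded ((summable_exp_shift hδ p).mul_left (C * M)) fun q => by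
    rw [Real.norm_eq_abs]; exact abs_ker_mul_le hK hf p q

/-- [folklore] `kerOp K f p` IS the sum of its series. -/
theorem hasSum_kerOp (hK : Decays K C δ) (hδ : 0 < δ) (hf : ∀ q, |f q| ≤ M) (p : Site 4) :
    HasSum (fun q : Site 4 => K p q () () * f q) (kerOp K f p) :=
  (summable_ker_mul hK hδ hf p).hasSum

/-- [folklore] **THE UNIFORM BOUND**: `|(K f)(p)| ≤ C·Zl 4 δ·M` for every `p` — a decaying kernel maps bounded forms to bounded forms. -/
theorem abs_kerOp_le (hK : Decays K C δ) (hδ : 0 < δ) (hf : ∀ q, |f q| ≤ M) (p : Site 4) :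
    |kerOp K f p| ≤ C * Zl 4 δ * M := by
  have h := tsum_of_norm_bounded (((summable_exp_shift hδ p).hasSum).mul_left (C * M))
    (f := fun q : Site 4 => K p q () () * f q) (fun q => by rw [Real.norm_eq_abs]; exact abs_ker_mul_le hK hf p q)
  rw [Real.norm_eq_abs, tsum_exp_shift] at h
  calc |kerOp K f p| ≤ C * M * Zl 4 δ := h
    _ = C * Zl 4 δ * M := by ring

/-- [folklore] Linearity in the form: differences. -/
theorem kerOp_sub (hK : Decays K C δ) (hδ : 0 < δ) (hf : ∀ q, |f q| ≤ M) (hg : ∀ q, |g q| ≤ M') (p : Site 4) :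
    kerOp K (f - g) p = kerOp K f p - kerOp K g p := by
  simp only [kerOp_apply, Pi.sub_apply, mul_sub]
  exact (summable_ker_mul hK hδ hf p).tsum_sub (summable_ker_mul hK hδ hg p)

/-- [folklore] Linearity in the form: scalars (no summability needed). -/
theorem kerOp_smul (K : MKer 4 Unit) (c : ℝ) (f : Form0 4 ℝ) (p : Site 4) : kerOp K (c • f) p = c * kerOp K f p := by
  simp only [kerOp_apply, Pi.smul_apply, smul_eq_mul]
  rw [← tsum_mul_left]
  exact tsum_congr fun q => by ring

/-- [folklore] Linearity in the kernel: differences. -/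
theorem kerOp_sub_ker (hK : Decays K C δ) (hδ : 0 < δ) (hK' : Decays K' C' δ') (hδ' : 0 < δ') (hf : ∀ q, |f q| ≤ M) (p : Site 4) :
    kerOp (K - K') f p = kerOp K f p - kerOp K' f p := by
  simp only [kerOp_apply]
  rw [← (summable_ker_mul hK hδ hf p).tsum_sub (summable_ker_mul hK' hδ' hf p)]
  exact tsum_congr fun q => by simp only [Pi.sub_apply]; ring

/-- [folklore] The Kronecker kernel acts as the identity: `Σ'_q [p = q]·f(q) = f(p)`. -/
theorem tsum_ite_mul (f : Form0 4 ℝ) (p : Site 4) : ∑' q : Site 4, (if p = q then (1 : ℝ) else 0) * f q = f p := by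
  rw [tsum_eq_single p (fun q hq => by rw [if_neg (Ne.symm hq), zero_mul]), if_pos rfl, one_mul]

end Zero

section Road

variable (n : ℕ) [NeZero n] (a : ℝ)

/-- [folklore] `R = 1 − P` decays (existential form; `RJetProjector.decays_Rgt`). -/
theorem spr_Rgt (ha : 0 < a) : Spr (Rgt n a) :=
  ⟨_, _, div_pos (deltaPP_pos 4 ha) (by have := NeZero.pos n; positivity), decays_Rgt n a ha⟩

/-- [folklore] **`R = 1 − P` ON FORMS**: for a bounded `g`, `(R g)(p) = g(p) − (P g)(p)`, i.e. `kerOp (Rgt n a) g = g − kerOp (Pgt n a) g`. -/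
theorem kerOp_Rgt (ha : 0 < a) {g : Form0 4 ℝ} {M : ℝ} (hg : ∀ q, |g q| ≤ M) (p : Site 4) :
    kerOp (Rgt n a) g p = g p - kerOp (Pgt n a) g p := by
  obtain ⟨C, δ, hδ, hP⟩ := spr_Pgt n a ha
  have h1 : Summable fun q : Site 4 => (if p = q then (1 : ℝ) else 0) * g q :=
    summable_of_ne_finset_zero (s := {p}) fun q hq => by
      rw [Finset.mem_singleton] at hq; rw [if_neg (Ne.symm hq), zero_mul]
  simp only [kerOp_apply, Rgt_apply, sub_mul]
  rw [(h1.tsum_sub (summable_ker_mul hP hδ hg p)), tsum_ite_mul]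

/-- [folklore] The same as an identity of forms. -/
theorem kerOp_Rgt_eq (ha : 0 < a) {g : Form0 4 ℝ} {M : ℝ} (hg : ∀ q, |g q| ≤ M) :
    kerOp (Rgt n a) g = g - kerOp (Pgt n a) g :=
  funext fun p => by rw [Pi.sub_apply]; exact kerOp_Rgt n a ha hg p

/-- [folklore] **`Rf` IS THE KERNEL OPERATOR OF `Rgt`** on bounded forms: `Rf n a g = kerOp (Rgt n a) g`. -/
theorem Rf_eq_kerOp_Rgt (ha : 0 < a) {g : Form0 4 ℝ} {M : ℝ} (hg : ∀ q, |g q| ≤ M) : Rf n a g = kerOp (Rgt n a) g := by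
  rw [Rf_eq, kerOp_Rgt_eq n a ha hg]

/-- [folklore] `Rf n a g` is bounded for bounded `g`. -/
theorem exists_bound_Rf (ha : 0 < a) {g : Form0 4 ℝ} {M : ℝ} (hg : ∀ q, |g q| ≤ M) : ∃ B' : ℝ, ∀ p, |Rf n a g p| ≤ B' := by
  obtain ⟨C, δ, hδ, hR⟩ := spr_Rgt n a ha
  exact ⟨_, fun p => by rw [Rf_eq_kerOp_Rgt n a ha hg]; exact abs_kerOp_le hR hδ hg p⟩

end Road

/-! ## §3 Fubini: a kernel applied to a kernel applied to a bounded form -/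

section Fubini

variable {K K' : MKer 4 Unit} {C C' δ δ' M : ℝ} {f : Form0 4 ℝ}

/-- [folklore] **FUBINI MAJORANT WITH A SUMMABLE ROW WEIGHT**: a two-variable family dominated by `φ(z)·C·e^{−δ|z−q|₁}` with `φ ≥ 0` summable and
`δ > 0` is summable on `ℤ⁴ × ℤ⁴` (`summable_prod_of_nonneg`; the inner sums are `φ(z)·C·Zl 4 δ`). -/
theorem summable_uncurry_of_rowMajorant {F : Site 4 → Site 4 → ℝ} {φ : Site 4 → ℝ} (hφ : Summable φ) (hφ0 : ∀ z, 0 ≤ φ z)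
    (hC : 0 ≤ C) (hδ : 0 < δ) (hF : ∀ z q, |F z q| ≤ φ z * (C * Real.exp (-δ * l1 (z - q)))) :
    Summable (Function.uncurry F) := by
  set g : Site 4 × Site 4 → ℝ := fun zq => φ zq.1 * (C * Real.exp (-δ * l1 (zq.1 - zq.2))) with hg
  have hg0 : 0 ≤ g := fun zq => by simp only [hg]; exact mul_nonneg (hφ0 _) (by positivity)
  have hgs : Summable g := by
    refine (summable_prod_of_nonneg hg0).2 ⟨fun z => ?_, ?_⟩
    · simpa only [hg] using ((summable_exp_shift hδ z).mul_left C).mul_left (φ z)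
    · have hrow : ∀ z : Site 4, ∑' q : Site 4, g (z, q) = φ z * (C * Zl 4 δ) := by
        intro z; simp only [hg]; rw [tsum_mul_left, tsum_mul_left, tsum_exp_shift]
      simp_rw [hrow]
      exact hφ.mul_right _
  refine Summable.of_norm_bounded hgs fun zq => ?_
  rw [Real.norm_eq_abs]
  exact hF zq.1 zq.2

/-- [folklore] The composition of two unit-leg kernels, read as a single series. -/
theorem comp_unit_apply (K K' : MKer 4 Unit) (p q : Site 4) :
    comp K K' p q () () = ∑' z : Site 4, K p z () () * K' z q () () := by
  simp only [comp, Finset.univ_unique, PUnit.default_eq_unit, Finset.sum_singleton]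

/-- [folklore] **FUBINI FOR KERNEL OPERATORS ON BOUNDED FORMS**: `K (K′ f) = (K ∘ K′) f` pointwise, for decaying `K`, `K′` (`δ, δ′ > 0`) and bounded `f`
— the double family `(z,q) ↦ K(p,z)·K′(z,q)·f(q)` is absolutely summable (row of `K` at `p` × uniform row-ℓ¹ bound of `K′` × `M`). -/
theorem kerOp_kerOp (hK : Decays K C δ) (hδ : 0 < δ) (hK' : Decays K' C' δ') (hδ' : 0 < δ') (hf : ∀ q, |f q| ≤ M) (p : Site 4) :
    kerOp K (kerOp K' f) p = kerOp (comp K K') f p := by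
  have hC : 0 ≤ C := hK.nonneg ()
  have hM : 0 ≤ M := bound_nonneg hf
  -- joint summability of F z q := K p z · (K' z q · f q)
  have hs : Summable (Function.uncurry fun z q : Site 4 => K p z () () * (K' z q () () * f q)) := by
    refine summable_uncurry_of_rowMajorant (φ := fun z => C * Real.exp (-δ * l1 (p - z)))
      ((summable_exp_shift hδ p).mul_left C) (fun z => by positivity) (mul_nonneg (hK'.nonneg ()) hM) hδ' fun z q => ?_
    rw [abs_mul]
    exact mul_le_mul (hK p z () ()) (abs_ker_mul_le hK' hf z q) (abs_nonneg _) (by positivity)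
  have h₁ : ∀ z : Site 4, Summable fun q : Site 4 => K p z () () * (K' z q () () * f q) := fun z => hs.prod_factor z
  have h₂ : ∀ q : Site 4, Summable fun z : Site 4 => K p z () () * (K' z q () () * f q) := fun q => hs.prod_symm.prod_factor q
  calc kerOp K (kerOp K' f) p = ∑' z : Site 4, K p z () () * ∑' q : Site 4, K' z q () () * f q := rfl
    _ = ∑' z : Site 4, ∑' q : Site 4, K p z () () * (K' z q () () * f q) := tsum_congr fun z => (tsum_mul_left).symm
    _ = ∑' q : Site 4, ∑' z : Site 4, K p z () () * (K' z q () () * f q) := (hs.tsum_comm' h₁ h₂).symm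
    _ = ∑' q : Site 4, (∑' z : Site 4, K p z () () * K' z q () ()) * f q := by
        refine tsum_congr fun q => ?_
        rw [← tsum_mul_right]
        exact tsum_congr fun z => by ring
    _ = kerOp (comp K K') f p := by
        rw [kerOp_apply]
        exact tsum_congr fun q => by rw [comp_unit_apply]

/-- [folklore] **THE RAW EXPORT (owner's requested shape for B6's `Gf ∘ Pf`)**: for `Spr K`, `Spr L` and a bounded `g`,
`Σ'_q K(p,q)·(Σ'_s L(q,s)·g(s)) = Σ'_s (K ∘ L)(p,s)·g(s)`. -/
theorem tsum_ker_mul_tsum {K L : MKer 4 Unit} (hK : Spr K) (hL : Spr L) {g : Form0 4 ℝ} {M : ℝ} (hg : ∀ s, |g s| ≤ M) (p : Site 4) :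
    ∑' q : Site 4, K p q () () * (∑' s : Site 4, L q s () () * g s) = ∑' s : Site 4, comp K L p s () () * g s := by
  obtain ⟨C, δ, hδ, hKd⟩ := hK
  obtain ⟨C', δ', hδ', hLd⟩ := hL
  exact kerOp_kerOp hKd hδ hLd hδ' hg p

end Fubini

/-! ## §4 Finite stencils pass through the series -/

section Stencils0

variable {K : MKer 4 Unit} {C δ M : ℝ} {f : Form0 4 ℝ}

/-- [folklore] **`d` THROUGH `Σ'`**: `(d (K f))_κ(x) = Σ'_q (K(x+e_κ,q) − K(x,q))·f(q)` (`KernelSpecInstance.hasSum_dz` at the family `q ↦ (p ↦ K(p,q) f(q))`). -/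
theorem hasSum_dz_kerOp (hK : Decays K C δ) (hδ : 0 < δ) (hf : ∀ q, |f q| ≤ M) (κ : Fin 4) (x : Site 4) :
    HasSum (fun q : Site 4 => (K (x + unitVec κ) q () () - K x q () ()) * f q) (dz (kerOp K f) κ x) := by
  have h := hasSum_dz (F := fun q : Site 4 => fun p : Site 4 => K p q () () * f q) (f := kerOp K f)
    (fun p => hasSum_kerOp hK hδ hf p) κ x
  refine h.congr_fun fun q => ?_
  simp only [dz]; ring

/-- [folklore] **`Δ₀ = δd` THROUGH `Σ'`**: `(δ d (K f))(x) = Σ'_q (δ d K(·,q))(x)·f(q)` — the shape in which bricks B3∕B5 read `Δ₀∘P` and `Δ₀∘G′`. -/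
theorem hasSum_codiff₁_dz_kerOp (hK : Decays K C δ) (hδ : 0 < δ) (hf : ∀ q, |f q| ≤ M) (x : Site 4) :
    HasSum (fun q : Site 4 => codiff₁ (dz (fun p : Site 4 => K p q () ())) x * f q) (codiff₁ (dz (kerOp K f)) x) := by
  have h := hasSum_codiff₁ (F := fun q : Site 4 => dz (fun p : Site 4 => K p q () () * f q)) (A := dz (kerOp K f))
    (fun κ p => hasSum_dz (F := fun q : Site 4 => fun p : Site 4 => K p q () () * f q) (f := kerOp K f)
      (fun p => hasSum_kerOp hK hδ hf p) κ p) x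
  refine h.congr_fun fun q => ?_
  simp only [codiff₁, dz, Finset.sum_mul]
  exact Finset.sum_congr rfl fun κ _ => by ring

/-- [folklore] `δ d (K f)` as a series, i.e. `δ d (K f) = kerOp (Δ₀K) f` with `(Δ₀K)(p,q) := (δ d K(·,q))(p)`. -/
theorem codiff₁_dz_kerOp (hK : Decays K C δ) (hδ : 0 < δ) (hf : ∀ q, |f q| ≤ M) (x : Site 4) :
    codiff₁ (dz (kerOp K f)) x = ∑' q : Site 4, codiff₁ (dz (fun p : Site 4 => K p q () ())) x * f q :=
  (hasSum_codiff₁_dz_kerOp hK hδ hf x).tsum_eq.symm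

/-- [folklore] **FINITE SUMS THROUGH `Σ'`**: `Σ_{p ∈ S} (K f)(p) = Σ'_q (Σ_{p ∈ S} K(p,q))·f(q)`. -/
theorem sum_kerOp (hK : Decays K C δ) (hδ : 0 < δ) (hf : ∀ q, |f q| ≤ M) (S : Finset (Site 4)) :
    ∑ p ∈ S, kerOp K f p = ∑' q : Site 4, (∑ p ∈ S, K p q () ()) * f q := by
  simp only [kerOp_apply]
  rw [← Summable.tsum_finsetSum (fun p _ => summable_ker_mul hK hδ hf p)]
  exact tsum_congr fun q => by rw [Finset.sum_mul]

/-- [folklore] **BLOCK SUMS THROUGH `Σ'`**: `Q′(K f)(y) = Σ'_q Q′(K(·,q))(y)·f(q)` (`AffineAveraging.blockSum`). -/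
theorem blockSum_kerOp (hK : Decays K C δ) (hδ : 0 < δ) (hf : ∀ q, |f q| ≤ M) (n : ℕ) (y : Site 4) :
    blockSum n (kerOp K f) y = ∑' q : Site 4, blockSum n (fun p : Site 4 => K p q () ()) y * f q := by
  simp only [blockSum, kerOp_apply]
  rw [← Summable.tsum_finsetSum (fun b _ => summable_ker_mul hK hδ hf _)]
  exact tsum_congr fun q => by rw [Finset.sum_mul]

end Stencils0

section Stencils1

variable {K : MKer 4 (Fin 4)} {C δ M : ℝ} {b : Form1 4 ℝ}

/-- [folklore] Termwise majorant for the 1-form operator: `|Σ_l K(x,z)_{κl} b_l(z)| ≤ 4·C·M·e^{−δ|x−z|₁}`. -/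
theorem abs_col_mul_le (hK : Decays K C δ) (hb : ∀ l z, |b l z| ≤ M) (κ : Fin 4) (x z : Site 4) :
    |∑ l, K x z κ l * b l z| ≤ 4 * (C * M) * Real.exp (-δ * l1 (x - z)) := by
  have hl : ∀ l, |K x z κ l * b l z| ≤ C * M * Real.exp (-δ * l1 (x - z)) := fun l => by
    rw [abs_mul]
    calc |K x z κ l| * |b l z| ≤ (C * Real.exp (-δ * l1 (x - z))) * M :=
          mul_le_mul (hK x z κ l) (hb l z) (abs_nonneg _) ((abs_nonneg _).trans (hK x z κ l))
      _ = C * M * Real.exp (-δ * l1 (x - z)) := by ring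
  calc |∑ l, K x z κ l * b l z| ≤ ∑ l, |K x z κ l * b l z| := Finset.abs_sum_le_sum_abs _ _
    _ ≤ ∑ _l : Fin 4, C * M * Real.exp (-δ * l1 (x - z)) := Finset.sum_le_sum fun l _ => hl l
    _ = 4 * (C * M) * Real.exp (-δ * l1 (x - z)) := by
        rw [Finset.sum_const, Finset.card_univ, Fintype.card_fin, nsmul_eq_mul]; push_cast; ring

/-- [folklore] **ROW SUMMABILITY OF THE 1-FORM OPERATOR.** -/
theorem summable_col_mul (hK : Decays K C δ) (hδ : 0 < δ) (hb : ∀ l z, |b l z| ≤ M) (κ : Fin 4) (x : Site 4) :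
    Summable fun z : Site 4 => ∑ l, K x z κ l * b l z :=
  Summable.of_norm_bounded ((summable_exp_shift hδ x).mul_left (4 * (C * M))) fun z => by
    rw [Real.norm_eq_abs]; exact abs_col_mul_le hK hb κ x z

/-- [folklore] `kerOp₁ K b κ x` IS the sum of its series. -/
theorem hasSum_kerOp₁ (hK : Decays K C δ) (hδ : 0 < δ) (hb : ∀ l z, |b l z| ≤ M) (κ : Fin 4) (x : Site 4) :
    HasSum (fun z : Site 4 => ∑ l, K x z κ l * b l z) (kerOp₁ K b κ x) :=
  (summable_col_mul hK hδ hb κ x).hasSum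

/-- [folklore] **THE UNIFORM BOUND FOR THE 1-FORM OPERATOR**: `|(kerOp₁ K b)_κ(x)| ≤ 4·C·Zl 4 δ·M`. -/
theorem abs_kerOp₁_le (hK : Decays K C δ) (hδ : 0 < δ) (hb : ∀ l z, |b l z| ≤ M) (κ : Fin 4) (x : Site 4) :
    |kerOp₁ K b κ x| ≤ 4 * C * Zl 4 δ * M := by
  have h := tsum_of_norm_bounded (((summable_exp_shift hδ x).hasSum).mul_left (4 * (C * M)))
    (f := fun z : Site 4 => ∑ l, K x z κ l * b l z) (fun z => by rw [Real.norm_eq_abs]; exact abs_col_mul_le hK hb κ x z)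
  rw [Real.norm_eq_abs, tsum_exp_shift] at h
  calc |kerOp₁ K b κ x| ≤ 4 * (C * M) * Zl 4 δ := h
    _ = 4 * C * Zl 4 δ * M := by ring

/-- [folklore] **`curv` THROUGH `Σ'`**: the curvature of `kerOp₁ K b` is the series of the curvatures of the weighted columns. -/
theorem hasSum_curv_kerOp₁ (hK : Decays K C δ) (hδ : 0 < δ) (hb : ∀ l z, |b l z| ≤ M) (κ' l' : Fin 4) (x : Site 4) :
    HasSum (fun z : Site 4 => curv (fun κ p => ∑ l, K p z κ l * b l z) κ' l' x) (curv (kerOp₁ K b) κ' l' x) :=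
  hasSum_curv (F := fun z : Site 4 => fun κ p => ∑ l, K p z κ l * b l z) (A := kerOp₁ K b) (fun κ p => hasSum_kerOp₁ hK hδ hb κ p) κ' l' x

/-- [folklore] **`curvAdj ∘ curv` THROUGH `Σ'`** (the Euler–Lagrange operator of brick B6's (el)). -/
theorem hasSum_curvAdj_curv_kerOp₁ (hK : Decays K C δ) (hδ : 0 < δ) (hb : ∀ l z, |b l z| ≤ M) (μ : Fin 4) (y : Site 4) :
    HasSum (fun z : Site 4 => curvAdj (curv (fun κ p => ∑ l, K p z κ l * b l z)) μ y) (curvAdj (curv (kerOp₁ K b)) μ y) :=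
  hasSum_curvAdj (F := fun z : Site 4 => curv (fun κ p => ∑ l, K p z κ l * b l z)) (G := curv (kerOp₁ K b))
    (fun κ' l' x => hasSum_curv_kerOp₁ hK hδ hb κ' l' x) μ y

/-- [folklore] **`δ` THROUGH `Σ'`** (codifferential of the 1-form operator). -/
theorem hasSum_codiff₁_kerOp₁ (hK : Decays K C δ) (hδ : 0 < δ) (hb : ∀ l z, |b l z| ≤ M) (x : Site 4) :
    HasSum (fun z : Site 4 => codiff₁ (fun κ p => ∑ l, K p z κ l * b l z) x) (codiff₁ (kerOp₁ K b) x) :=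
  hasSum_codiff₁ (F := fun z : Site 4 => fun κ p => ∑ l, K p z κ l * b l z) (A := kerOp₁ K b) (fun κ p => hasSum_kerOp₁ hK hδ hb κ p) x

/-- [folklore] **`𝒬 = contourSum n` THROUGH `Σ'`** (the straight-contour block sums of the 1-form operator). -/
theorem hasSum_contourSum_kerOp₁ (hK : Decays K C δ) (hδ : 0 < δ) (hb : ∀ l z, |b l z| ≤ M) (n : ℕ) (κ : Fin 4) (y : Site 4) :
    HasSum (fun z : Site 4 => contourSum n (fun κ p => ∑ l, K p z κ l * b l z) κ y) (contourSum n (kerOp₁ K b) κ y) :=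
  hasSum_contourSum (F := fun z : Site 4 => fun κ p => ∑ l, K p z κ l * b l z) (A := kerOp₁ K b) (fun κ p => hasSum_kerOp₁ hK hδ hb κ p) κ y

end Stencils1

/-! ## §5 Brick B1 on forms: the block sums of `G′(R g)` vanish -/

section BlockSums

variable (n : ℕ) [NeZero n] (a : ℝ)

/-- [folklore] **`G′ ∘ R` VERSUS `R ∘ G′`**: `comp (Ggh n a) (Rgt n a) (p,q) = RG (Ggh n a) (Pgt n a) (q,p)` — both equal `G′(p,q) − Σ'_z G′(p,z)P(z,q)`, by the
symmetry of `G′` and `P`. -/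
theorem comp_Ggh_Rgt_eq (ha : 0 < a) (p q : Site 4) : comp (Ggh n a) (Rgt n a) p q () () = RG (Ggh n a) (Pgt n a) q p () () := by
  have hG : Summable fun z : Site 4 => Ggh n a p z () () * (if z = q then (1 : ℝ) else 0) :=
    summable_of_ne_finset_zero (s := {q}) fun z hz => by
      rw [Finset.mem_singleton] at hz; rw [if_neg hz, mul_zero]
  have hGP : Summable fun z : Site 4 => Ggh n a p z () () * Pgt n a z q () () :=
    (summable_Pgt_mul_Ggh n a ha q p () ()).congr fun z => by rw [Ggh_symm n a ha p z () (), Pgt_symm n ha q z () (), mul_comm]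
  have e1 : comp (Ggh n a) (Rgt n a) p q () () = Ggh n a p q () () - ∑' z : Site 4, Ggh n a p z () () * Pgt n a z q () () := by
    rw [comp_unit_apply]
    simp only [Rgt_apply, mul_sub]
    rw [hG.tsum_sub hGP, tsum_eq_single q (fun z hz => by rw [if_neg hz, mul_zero]), if_pos rfl, mul_one]
  have e2 : RG (Ggh n a) (Pgt n a) q p () () = Ggh n a q p () () - comp (Pgt n a) (Ggh n a) q p () () := rfl
  rw [e1, e2, comp_unit_apply, Ggh_symm n a ha q p () ()]
  congr 1
  exact tsum_congr fun z => by rw [Ggh_symm n a ha p z () (), Pgt_symm n ha q z () (), mul_comm]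

/-- [folklore] **BRICK B1 ON FORMS — `Q′·G′·R = 0`**: for every BOUNDED fine 0-form `g` and every block `y`,
`Σ_{p ∈ B (n−1) y} (G′(R g))(p) = 0`, where `G′ g := kerOp (Ggh n a) g`, `R g := kerOp (Rgt n a) g = g − P g` (§3 Fubini ⨾ `comp_Ggh_Rgt_eq` ⨾
`LandauMultiplierMean.sum_blk_tsum_RG_mul_eq_zero`). Hypothesis (M) of `KKTFluctuationUnique.SolvesKKT` for the dictionary's multipliers, in operator language. -/
theorem sum_blk_kerOp_Ggh_Rgt_eq_zero (ha : 0 < a) {g : Form0 4 ℝ} {M : ℝ} (hg : ∀ q, |g q| ≤ M) (y : Site 4) :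
    ∑ p ∈ B (n - 1) y, kerOp (Ggh n a) (kerOp (Rgt n a) g) p = 0 := by
  obtain ⟨C, δ, hδ, hG⟩ := spr_Ggh n a ha
  obtain ⟨C', δ', hδ', hR⟩ := spr_Rgt n a ha
  have e : ∀ p, kerOp (Ggh n a) (kerOp (Rgt n a) g) p = ∑' q : Site 4, RG (Ggh n a) (Pgt n a) q p () () * g q := fun p => by
    rw [kerOp_kerOp hG hδ hR hδ' hg p, kerOp_apply]
    exact tsum_congr fun q => by rw [comp_Ggh_Rgt_eq n a ha p q]
  simp only [e]
  exact sum_blk_tsum_RG_mul_eq_zero n a ha hg y () ()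

/-- [folklore] **`Q′·(G′(R g)) = 0` IN THE OWNER's VOCABULARY**: `blockSum n (Gf n a (Rf n a g)) y = 0` for every bounded `g` and every block `y`
(`Gf_eq_kerOp`, `Rf_eq_kerOp_Rgt`, `TowerEquationForms.sum_B_eq_blockSum`) — hypothesis (M) of `SolvesKKT` for the multipliers `−n²·G′R(δℋ_R)` ∕ `−n²·G′R(δΓ_R)`. -/
theorem blockSum_Gf_Rf_eq_zero (ha : 0 < a) {g : Form0 4 ℝ} {M : ℝ} (hg : ∀ q, |g q| ≤ M) (y : Site 4) :
    blockSum n (Gf n a (Rf n a g)) y = 0 := by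
  rw [← sum_B_eq_blockSum, Gf_eq_kerOp, Rf_eq_kerOp_Rgt n a ha hg]
  exact sum_blk_kerOp_Ggh_Rgt_eq_zero n a ha hg y

/-- [folklore] `G′(R g)` is bounded for bounded `g` (so it is admissible, bounded data for `KKTFluctuationUnique`). -/
theorem exists_bound_Gf_Rf (ha : 0 < a) {g : Form0 4 ℝ} {M : ℝ} (hg : ∀ q, |g q| ≤ M) : ∃ B' : ℝ, ∀ p, |Gf n a (Rf n a g) p| ≤ B' := by
  obtain ⟨C, δ, hδ, hG⟩ := spr_Ggh n a ha
  obtain ⟨C', δ', hδ', hR⟩ := spr_Rgt n a ha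
  exact ⟨_, fun p => by rw [Gf_eq_kerOp, Rf_eq_kerOp_Rgt n a ha hg]; exact abs_kerOp_le hG hδ (fun q => abs_kerOp_le hR hδ' hg q) p⟩

end BlockSums

end

end Summit.QuantumFields.BalabanUV.Beta.D1BFx.KernelFormOperators
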